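import Literature.IUT.HodgeTheaters.InitialThetaDataTorsionInvarianceProofs
import Literature.NumberTheory.EllipticCurves.MultiplicativeReductionBaseChangeTorsionProofs
import HarnessLib

/-!
# [IUTchI] Example 3.2 (iv), valuation half, FROM initial Θ-data: `2l ∣ ord_{v̲}(q_{v̲})` at the bad places of `K`

`Proofs` file (theorems only; no definition, no named fact, no instance) of the cell `abc-iut` (wave-5
prover abc-iut-w5-d158).  S. Mochizuki, *Inter-universal Teichmüller theory I*, kurims manuscript (May
2020), Example 3.2 (iv) p. 71: "Write `q_v` for the `q`-parameter of the elliptic curve `E_v` over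
`K_v` … Note that it follows from our assumption concerning `2`-torsion [cf. Definition 3.1, (b)],
together with the definition of “`K`” [cf. Definition 3.1, (c)], that `q_v` admits a `2l`-th root in
`𝒪^▷(T_{X̲̲_v}) (≅ 𝒪^▷_{K_v})`."  At the level of VALUATIONS — `2l ∣ ord_{v̲}(q_{v̲}) =
ord_{v̲}(Δ_min(E_F ⊗ K))` at every finite place `v̲` of `K` over `𝕍(F)^bad` — this is now a KERNEL
THEOREM about abc-iut-L5-t2's `InitialThetaData F K Fbar E l P`, assembled from:

* `InitialThetaData.forall_smul_geomTorsion_baseChange_two` / `_l`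
  (`InitialThetaDataTorsionInvarianceProofs`: Def. 3.1 (b) `torsion_six_rational` and (c) `range_K_iff`
  ⟹ `G_K` fixes `E_K[2]`, `E_K[l]` pointwise);
* `WeierstrassCurve.two_mul_dvd_ordMinimalDiscriminant_baseChange_of_forall_smul_geomTorsion_eq`
  (`MultiplicativeReductionBaseChangeTorsionProofs`: base change of multiplicative reduction where
  `E_K` is semistable — Raynaud / [IUTchIV] Prop. 1.8 (v) — and the contrapositive of the tree's
  Kodaira–Néron transvection theorem, Silverman *ATAEC* V.6.1: pointwise-rational `p`-torsion at a
  multiplicative place `v ∤ p` forces `p ∣ ord_v(Δ_min)`);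
* Def. 3.1 (b) `multiplicative_over_VbadMod` and (c) `l_prime`, `five_le_l` of the datum.

Theorems (for `D : InitialThetaData F K Fbar E l P`, `x` a finite place of `F`, `v̲` a finite place of
`K` over `x`, with `v̲ ∤ 2`, `v̲ ∤ l` — Def. 3.1 (b)(c): the bad places have ODD residue characteristic
PRIME TO `l`, `VbadMod_odd` / `l_ne_residueChar`, read at `v̲`):
* `InitialThetaData.two_mul_dvd_ordMinimalDiscriminant_baseChange_of_hasMultiplicativeReductionAt` —
  `E_F` multiplicative at `x` ⟹ `2l ∣ ord_{v̲}(Δ_min(E_F ⊗ K))`;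
* `InitialThetaData.two_mul_dvd_ordMinimalDiscriminant_baseChange_of_mem_VFbad` — `x ∈ 𝕍(F)^bad` ⟹
  the same;
* `InitialThetaData.hasMultiplicativeReductionAt_baseChange_of_mem_VFbad` — `E_F ⊗ K` has
  multiplicative reduction at `v̲` ([IUTchI] Def. 3.1 (b) read over `K`: "`𝕍(K)^bad`");
* `InitialThetaData.two_not_mem_and_l_not_mem_of_mem_VFbad` — `v̲ ∤ 2`, `v̲ ∤ l` themselves FOLLOW from
  Def. 3.1 (b)(c) (`VbadMod_odd`, `l_ne_residueChar`), whence the hypothesis-free forms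
  **`InitialThetaData.two_mul_dvd_ordMinimalDiscriminant_baseChange`** and
  **`InitialThetaData.hasMultiplicativeReductionAt_baseChange`** (everything from the datum).

What this is NOT: the `2l`-th ROOT `q̲_{v̲}` itself (the unit part of `q_{v̲}` being a `2l`-th power)
needs Tate uniformisation (the tree's named fact `TateCurve.uniformization`) and is not claimed — the
Cor. 3.12 provenance clause (hbadD) of `Summits/ABC/IUTFork/Cor312ProvenanceFramesDegree.lean` reads only
the norm of the `q`-centre, i.e. only this valuation statement.  Classical number theory throughout;
nothing of [IUTchI–IV] is asserted (the `InitialThetaData` fields are hypotheses); no side is taken on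
[IUTchIII] Cor. 3.12.
-/

noncomputable section

open scoped Classical
open NumberField IsDedekindDomain

universe u

namespace Literature.IUT.HodgeTheaters

namespace InitialThetaData

open WeierstrassCurve Literature.NumberTheory.EllipticCurves Literature.NumberTheory.GaloisRepresentations

variable {F : Type u} {K : Type u} {Fbar : Type u} [Field F] [NumberField F] [Field K] [NumberField K]
  [Algebra F K] [Field Fbar] [Algebra F Fbar] [Algebra K Fbar] {E : WeierstrassCurve F} [E.IsElliptic]
  {l : ℕ} {P : BadPlacePredicates K}

/-- **[IUTchI] Ex. 3.2 (iv), valuation half, from initial Θ-data: `2l ∣ ord_{v̲}(Δ_min(E_F ⊗ K))`** at a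
finite place `v̲` of `K` lying over a place `x` of `F` where `E_F` has multiplicative reduction, with
`v̲ ∤ 2`, `v̲ ∤ l` (Def. 3.1 (b) `2`-torsion rational + (c) `K = F(E_F[l])`, `l ≥ 5` prime; Silverman
*AEC* VII.5.1/VII.6.1, *ATAEC* V.6.1).  `ord_{v̲}(Δ_min) = ord_{v̲}(q_{v̲})` (Tate), so this is
"`q_{v̲}` admits a `2l`-th root" at the level of valuations.
[cite: Mochizuki2012, IUTchI Ex. 3.2 (iv) p.71] [cite: SilvermanATAEC1994, V.6 Prop. 6.1 (p. 410)] -/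
theorem two_mul_dvd_ordMinimalDiscriminant_baseChange_of_hasMultiplicativeReductionAt
    (D : InitialThetaData F K Fbar E l P) {x : HeightOneSpectrum (𝓞 F)} {vK : HeightOneSpectrum (𝓞 K)}
    [vK.asIdeal.LiesOver x.asIdeal] (hmult : E.HasMultiplicativeReductionAt x)
    (h2 : (2 : 𝓞 K) ∉ vK.asIdeal) (hl : (l : 𝓞 K) ∉ vK.asIdeal) :
    2 * l ∣ (E.baseChange K).ordMinimalDiscriminant vK :=
  E.two_mul_dvd_ordMinimalDiscriminant_baseChange_of_forall_smul_geomTorsion_eq hmult D.l_prime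
    (by have := D.five_le_l; omega) h2 hl
    (D.forall_smul_geomTorsion_baseChange_two) (D.forall_smul_geomTorsion_baseChange_l)

/-- **The same at a place of `𝕍(F)^bad`** (Def. 3.1 (b): "`X_F` has bad [multiplicative] reduction at the
elements of `𝕍(F)` that lie over `𝕍^bad_mod`", the field `multiplicative_over_VbadMod`): for
`x ∈ 𝕍(F)^bad` and `v̲ ∣ x` a finite place of `K` with `v̲ ∤ 2`, `v̲ ∤ l`,
`2l ∣ ord_{v̲}(Δ_min(E_F ⊗ K)) = ord_{v̲}(q_{v̲})`. [cite: Mochizuki2012, IUTchI Ex. 3.2 (iv) p.71] -/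
theorem two_mul_dvd_ordMinimalDiscriminant_baseChange_of_mem_VFbad
    (D : InitialThetaData F K Fbar E l P) {x : FinitePlace F} (hx : x ∈ D.VFbad)
    {vK : HeightOneSpectrum (𝓞 K)} [vK.asIdeal.LiesOver x.maximalIdeal.asIdeal]
    (h2 : (2 : 𝓞 K) ∉ vK.asIdeal) (hl : (l : 𝓞 K) ∉ vK.asIdeal) :
    2 * l ∣ (E.baseChange K).ordMinimalDiscriminant vK :=
  D.two_mul_dvd_ordMinimalDiscriminant_baseChange_of_hasMultiplicativeReductionAt
    (D.multiplicative_over_VbadMod x hx) h2 hl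

/-- **`E_F ⊗ K` has multiplicative reduction at every finite place `v̲ ∤ l` of `K` over `𝕍(F)^bad`**
([IUTchI] Def. 3.1 (b) read over `K` — the places "`𝕍(K)^bad`" of Def. 3.1 (e) are places of bad
MULTIPLICATIVE reduction of `E_K`): `E_K` is semistable at `v̲` because `G_K` fixes `E_K[l]`
([IUTchIV] Prop. 1.8 (v)), and `|j|_{v̲} > 1`. [cite: Mochizuki2012, IUTchI Def. 3.1 (b)(e) pp.61-62] -/
theorem hasMultiplicativeReductionAt_baseChange_of_mem_VFbad
    (D : InitialThetaData F K Fbar E l P) {x : FinitePlace F} (hx : x ∈ D.VFbad)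
    {vK : HeightOneSpectrum (𝓞 K)} [vK.asIdeal.LiesOver x.maximalIdeal.asIdeal]
    (hl : (l : 𝓞 K) ∉ vK.asIdeal) : (E.baseChange K).HasMultiplicativeReductionAt vK :=
  E.hasMultiplicativeReductionAt_baseChange_of_forall_smul_geomTorsion_eq
    (D.multiplicative_over_VbadMod x hx) D.l_prime (by have := D.five_le_l; omega) hl
    (D.forall_smul_geomTorsion_baseChange_l)

/-- **The residue characteristic at a place of `K` over `𝕍(F)^bad` is odd and `≠ l`** ([IUTchI] Def. 3.1
(b) "`𝕍^bad_mod` … of odd residue characteristic", (c) "`l` is prime to the elements of `𝕍^bad_mod`";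
the fields `VbadMod_odd`, `l_ne_residueChar`), read at a finite place `v̲` of `K` over `x ∈ 𝕍(F)^bad`:
`2 ∉ v̲` and `l ∉ v̲`.  (The residue characteristic is computed on the place of `F_mod` below `x`;
`2`, `l ∈ v̲` would descend to it.) [cite: Mochizuki2012, IUTchI Def. 3.1 (b)(c) pp.61-62] -/
theorem two_not_mem_and_l_not_mem_of_mem_VFbad
    (D : InitialThetaData F K Fbar E l P) {x : FinitePlace F} (hx : x ∈ D.VFbad)
    {vK : HeightOneSpectrum (𝓞 K)} [hover : vK.asIdeal.LiesOver x.maximalIdeal.asIdeal] :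
    (2 : 𝓞 K) ∉ vK.asIdeal ∧ (l : 𝓞 K) ∉ vK.asIdeal := by
  -- the place `w` of `F_mod` below `x`, a member of `𝕍^bad_mod`
  obtain ⟨w, hw, hwx⟩ := hx
  set Pm : HeightOneSpectrum (𝓞 (fieldOfModuli E)) := x.maximalIdeal.under (𝓞 (fieldOfModuli E)) with hPm
  have hwx' : w = FinitePlace.mk Pm := by
    have h : Val.non w = Val.non (FinitePlace.mk Pm) := hwx
    exact Sum.inr_injective h
  have hodd : Odd (ringChar (𝓞 (fieldOfModuli E) ⧸ Pm.asIdeal)) := by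
    have h := D.VbadMod_odd w hw
    rwa [hwx', residueChar, NumberField.FinitePlace.maximalIdeal_mk] at h
  have hnel : ringChar (𝓞 (fieldOfModuli E) ⧸ Pm.asIdeal) ≠ l := by
    have h := D.l_ne_residueChar w hw
    rwa [hwx', residueChar, NumberField.FinitePlace.maximalIdeal_mk] at h
  -- a natural number lying in `v̲` lies in the place of `F_mod` below
  have hdesc : ∀ n : ℕ, (n : 𝓞 K) ∈ vK.asIdeal → (n : 𝓞 (fieldOfModuli E)) ∈ Pm.asIdeal := by
    intro n hn
    change (n : 𝓞 (fieldOfModuli E)) ∈ Ideal.comap (algebraMap (𝓞 (fieldOfModuli E)) (𝓞 F))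
      x.maximalIdeal.asIdeal
    rw [Ideal.mem_comap, map_natCast, hover.over, Ideal.under_def, Ideal.mem_comap, map_natCast]
    exact hn
  -- in the residue field `𝓞_{F_mod} / P_m` (nontrivial) a vanishing natural number is divisible by the
  -- (prime) characteristic
  haveI : Nontrivial (𝓞 (fieldOfModuli E) ⧸ Pm.asIdeal) := Ideal.Quotient.nontrivial_iff.mpr Pm.isPrime.ne_top
  have hchar : ∀ n : ℕ, (n : 𝓞 (fieldOfModuli E)) ∈ Pm.asIdeal →
      ringChar (𝓞 (fieldOfModuli E) ⧸ Pm.asIdeal) ∣ n := by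
    intro n hn
    rw [← ringChar.spec, ← map_natCast (Ideal.Quotient.mk Pm.asIdeal), Ideal.Quotient.eq_zero_iff_mem]
    exact hn
  have hne1 : ringChar (𝓞 (fieldOfModuli E) ⧸ Pm.asIdeal) ≠ 1 := by
    intro h1
    have h := (ringChar.spec (𝓞 (fieldOfModuli E) ⧸ Pm.asIdeal) 1).mpr (by rw [h1])
    simp only [Nat.cast_one, one_ne_zero] at h
  refine ⟨fun h2 => ?_, fun hl => ?_⟩
  · have hd := hchar 2 (hdesc 2 h2)
    rcases (Nat.dvd_prime Nat.prime_two).mp hd with h | h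
    · exact hne1 h
    · rw [h] at hodd
      exact (Nat.not_odd_iff_even.mpr (by decide)) hodd
  · have hd := hchar l (hdesc l hl)
    rcases (Nat.dvd_prime D.l_prime).mp hd with h | h
    · exact hne1 h
    · exact hnel h

/-- **[IUTchI] Example 3.2 (iv), valuation half, from the initial Θ-datum alone:** for every
`x ∈ 𝕍(F)^bad` and every finite place `v̲` of `K` over `x`, `2l ∣ ord_{v̲}(Δ_min(E_F ⊗ K)) =
ord_{v̲}(q_{v̲})` — "`q_v` admits a `2l`-th root in `𝒪^▷_{K_v}`" at the level of valuations, with ALL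
hypotheses discharged from Def. 3.1 (b)(c) (`multiplicative_over_VbadMod`, `torsion_six_rational`,
`VbadMod_odd`, `range_K_iff`, `l_prime`, `five_le_l`, `l_ne_residueChar`).
[cite: Mochizuki2012, IUTchI Ex. 3.2 (iv) p.71] [cite: SilvermanATAEC1994, V.6 Prop. 6.1 (p. 410)] -/
theorem two_mul_dvd_ordMinimalDiscriminant_baseChange
    (D : InitialThetaData F K Fbar E l P) {x : FinitePlace F} (hx : x ∈ D.VFbad)
    (vK : HeightOneSpectrum (𝓞 K)) [vK.asIdeal.LiesOver x.maximalIdeal.asIdeal] :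
    2 * l ∣ (E.baseChange K).ordMinimalDiscriminant vK :=
  have h := D.two_not_mem_and_l_not_mem_of_mem_VFbad hx (vK := vK)
  D.two_mul_dvd_ordMinimalDiscriminant_baseChange_of_mem_VFbad hx h.1 h.2

/-- **`E_F ⊗ K` has multiplicative reduction at every finite place of `K` over `𝕍(F)^bad`** ([IUTchI]
Def. 3.1 (b) read over `K`; all hypotheses from the datum). [cite: Mochizuki2012, IUTchI Def. 3.1 (b)(e) pp.61-62] -/
theorem hasMultiplicativeReductionAt_baseChange
    (D : InitialThetaData F K Fbar E l P) {x : FinitePlace F} (hx : x ∈ D.VFbad)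
    (vK : HeightOneSpectrum (𝓞 K)) [vK.asIdeal.LiesOver x.maximalIdeal.asIdeal] :
    (E.baseChange K).HasMultiplicativeReductionAt vK :=
  D.hasMultiplicativeReductionAt_baseChange_of_mem_VFbad hx
    (D.two_not_mem_and_l_not_mem_of_mem_VFbad hx (vK := vK)).2

end InitialThetaData

end Literature.IUT.HodgeTheaters

end
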